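import Summits.HodgeConjecture.CorCM.D2Bridge.ClosedPrintedMuKeyIdentLemD3DelRecConjOmegaT
import Summits.HodgeConjecture.CorCM.D2Bridge.ShimuraComponentMaps
import Literature.NumberTheory.Automorphic.Liu2021.NablaMapSurjectiveOfPieces
import HarnessLib

/-!
# [Liu 2021, Thm 4.18 (1)] input (I): the transition homomorphisms `Alb_{u^{K'}_K}` of `V`'s Albanese tower are EPIMORPHISMS

Cell `hodgecm-mathlib` (D-0151), fan A, rung A-III, skeleton `Lines/a3-liu418.lean` v3 (sha16 1b96ade3f8b6b529), registered sub-stub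
(I) `stub_albTransitionEpi : StubAlbTransitionEpi` (:501 / :629; KEY `a3-level-invariants`, seat A-p07; cell INVENTORY §8.2 row VI-3
`AlbTransitionEpi`).  With (D) `stub_honestIsogenyDescent` it yields item (1) of [Liu2021, Thm 4.18] by the skeleton's theorem
`stub_levelInvariants_of` (A-p07 p593390).

`StubAlbTransitionEpi` says: for every `hDel` (Deligne's canonical models, [Deligne1979] 2.2.5 / Cor. 2.7.21 — the binder, NOT proved
here) and every face `(F, ι₁, V, Φ)` with `6 ≤ [F:ℚ]`, every transition homomorphism `Alb_{u^{K'}_K} = (ℭ_V).Atr f` of the Albanese tower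
of `ℭ_V = sec42DataOf (exists_recordSystem_of_printed hDel) isoOf F ι₁ V̂ Φ` (Liu's §4.2 datum ON the canonical models: `X_K = M_K ⊗_{F,c} F`,
`A_K := Alb X_K`) is an epimorphism of abelian varieties.  PROOF (three steps, all kernel-checked; nothing of [Liu2021] is cited as a fact):

* §1 `recordSystem_pieces_pair_lift` — for ANY record system `S` of Deligne's models ([Deligne1979] 2.1.2–2.1.4 as typed in
  `UnitaryShimuraCanonicalModel.RecordSystem`) and `f : K' ⟶ K`: the complex fibre `M_K ⊗_{L,τ} ℂ` is the coproduct of the ball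
  quotients `X_q` (field `pieces`), and ANY two complex points of one piece `X_q` — `[x₁, g_q K]`, `[x₂, g_q K]` after
  `surjOn_unif` + `exists_ball_smul_of_mem_negCone` — are the images under `(M_{K'} → M_K)_τ` of two complex points of ONE piece of
  `M_{K'} ⊗ ℂ`: `[γ xᵢ, g'_{q'} K']` with `q' = [g_q]` and `γ ∈ U(H)(L⁺)` from `exists_rational_rep` (`[x, g_q K'] = [γ x, g'_{q'} K']`,
  `ShimuraSet.mk_eq_mk_iff`), because the transitions act by `[z, aK'] ↦ [z, aK]` (field `map_pts`, [Deligne1979] 2.1.4).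
* §2 `albTransitionEpi_sec42DataOfFourLe` — transport to the honest datum `sec42DataOfFourLe h V Φ h4 iso` (`4 ≤ [F:ℚ]`): its `X_K` is
  `M_K ⊗_{F,c} F` for the total record functor `M = recordFunctorOf h V ≅ (recordOf h V h4).M` (`recordFunctorOfIso`), so along
  `ῑ₁ = conj ∘ ι₁` we have `X_K ⊗_{F,ῑ₁} ℂ ≅ M_K ⊗_{F,ι₁} ℂ` naturally in `K` (transitivity of base change `baseChangeHomObjIsoOfComp`,
  `ῑ₁ ∘ c = ι₁`); then the tree's generic engine `Sec42Data.epi_Atr_of_pieces_lift_iso` (A-p07, `Liu2021/NablaMapSurjectiveOfPieces.lean`: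
  `∇u` hits every `ℂ`-point of `∇X_K` — finite Galois splitting + `∇`-descent inside `Nabla.exists_mem_range_tensorHom_baseChange_complex` —
  hence `Alb_u` is epi by the uniqueness half of the Albanese universal property, `AlbaneseMapEpi.lean`) applies to §1 at
  `S := recordOf h V h4`.
* §3 `stubAlbTransitionEpi_holds` — `StubAlbTransitionEpi` VERBATIM (`CV` unfolded): `sec42DataOf = sec42DataOfFourLe` under `6 ≤ [F:ℚ]`
  (`Model.sec42DataOf_eq_of_four_le`, a `dif_pos`), rewritten under the level binders.

ORIENTATION: none used (item (1) is orientation-free).  HC_CM is proved only modulo the 7 printed citations (`hDel`, `h21`, `hLiu418`,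
`h411`, `h413`, `hD3`, `hD1''`) until rung 0 closes; this file removes no binder by itself — it closes the registered sub-stub (I) of
`hLiu418`'s line, CONDITIONAL on nothing beyond the stub's own binder `hDel`.

References: [Liu2021] Y. Liu, *Fourier–Jacobi cycles and arithmetic relative trace formula*, Camb. J. Math. 9 (2021) = arXiv:2102.11518,
Thm. 4.18 (1) with proof (FJcycle.tex l. 2239, 2247–2282), §4.2 l. 2060–2072, Def. 2.1 (1), Def. 2.3, Lem. 2.4 (1); [Deligne1979] P. Deligne,
*Variétés de Shimura*, Proc. Symp. Pure Math. 33.2 (1979), 2.1.2–2.1.4, 2.2.5; [Milne2005] J. S. Milne, *Introduction to Shimura varieties*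
(2005), Lemma 5.13 p. 57.
-/

set_option autoImplicit false

noncomputable section

namespace Summit.HodgeConjecture.CorCM.Lines.A3Liu418

open CategoryTheory CategoryTheory.Limits AlgebraicGeometry NumberField MulAction
open scoped Matrix
open Literature.AlgebraicGeometry.Motives
open Literature.AlgebraicGeometry.ShimuraVarieties (negCone UnitaryBallUniformisationDatum)
open Literature.AlgebraicGeometry.ShimuraVarieties.UnitaryCanonicalModel
open Literature.NumberTheory.Automorphic Literature.NumberTheory.Automorphic.UnitaryGroup
open Literature.NumberTheory.Automorphic.ShimuraDissection
open Literature.NumberTheory.Automorphic.Liu2021 Literature.NumberTheory.Automorphic.Liu2021.AppendixC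
open Literature.Geometry.ComplexHyperbolic Literature.Geometry.ComplexHyperbolic.BallModel
open Summit.HodgeConjecture.CorCM.D2Bridge (exists_ball_smul_of_mem_negCone AlgPoints.baseChangeEquiv_map)
open Summit.HodgeConjecture.CorCM.Model Summit.HodgeConjecture.CorCM.HComp

/-! ## §1 Record systems: same-piece pairs of complex points lift along the transition morphisms -/

section Record

variable {L : Type} [Field L] [NumberField L] [IsCMField L] {H : Matrix (Fin 3) (Fin 3) L}
  {τ : L →+* ℂ} {T : GL (Fin 3) ℂ} {hT : formCongr (starRingEnd ℂ) T (H.map τ) = BallModel.J}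
  {K₀ : C5.OpenCompactSubgroup ↥(finAdelic (↥(maximalRealSubfield L)) L (IsCMField.complexConj L) 3 H)}

set_option maxHeartbeats 800000 in -- elaboration (`whnf` in the statement's `pieces` clause); fails at 400 k, default elsewhere
/-- **Same-piece pairs of complex points lift along the transition morphisms of Deligne's models.**  For a record system `S` of the
canonical models `M_K` ([Deligne1979] 2.1.2–2.1.4, 2.2.5, typed as `RecordSystem`) and `f : K' ⟶ K` (`K' ≤ K ≤ K₀`): the complex fibre
`M_K ⊗_{L,τ} ℂ` is the coproduct of geometrically irreducible pieces (the ball quotients `X_q` of the field `pieces`, smooth projective),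
`M_{K'} ⊗_{L,τ} ℂ` receives the geometrically irreducible pieces `X'_{q'}`, and any two complex points of one `X_q` are the images under
`(M_{K'} → M_K) ⊗ ℂ` of two complex points of one `X'_{q'}`.  KERNEL: a complex point of `X_q` is `unif (T·lift x)` for a ball point `x`
(`surjOn_unif`, `exists_ball_smul_of_mem_negCone`, `unif_smul`), i.e. `[x, g_q K]` in `Sh_K(ℂ)` (point formula of `pieces`); at level `K'`
the class `q' = [g_q]` has `[x, g_q K'] = [γ x, g'_{q'} K']` for a rational `γ` (`exists_rational_rep`, `ShimuraSet.mk_eq_mk_iff`), and the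
transition is `[z, aK'] ↦ [z, aK]` (`map_pts`).  This is exactly the input `hlift` of `Nabla.exists_comp_eq_of_pieces_lift`.
[cite: Deligne1979ShimuraVarieties, 2.1.2–2.1.4] [cite: Milne2005ShimuraVarieties, Lemma 5.13 p. 57] -/
theorem recordSystem_pieces_pair_lift (S : RecordSystem L H τ T hT K₀) {K K' : C5.SmallLevel K₀} (f : K' ⟶ K) :
    ∃ (κ κ' : Type) (P : κ → SchemeOver ℂ) (P' : κ' → SchemeOver ℂ)
      (inj : ∀ c, P c ⟶ (baseChangeHom τ).obj (S.M.obj K)) (_ : ∀ c, GeometricallyIrreducible (P c).hom)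
      (_ : IsColimit (Cofan.mk ((baseChangeHom τ).obj (S.M.obj K)) inj))
      (inj' : ∀ c', P' c' ⟶ (baseChangeHom τ).obj (S.M.obj K')) (_ : ∀ c', GeometricallyIrreducible (P' c').hom),
      ∀ (c : κ) (z₁ z₂ : ComplexPoints (P c)), ∃ (c' : κ') (z₁' z₂' : ComplexPoints (P' c')),
        AlgPoints.map (inj' c' ≫ (baseChangeHom τ).map (S.M.map f)) z₁' = AlgPoints.map (inj c) z₁ ∧
          AlgPoints.map (inj' c' ≫ (baseChangeHom τ).map (S.M.map f)) z₂' = AlgPoints.map (inj c) z₂ := by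
  letI : Algebra L ℂ := τ.toAlgebra
  classical
  obtain ⟨g, hg, X, ι, hcol, B, hB⟩ := S.pieces K
  obtain ⟨g', hg', X', ι', -, B', hB'⟩ := S.pieces K'
  refine ⟨_, _, X, X', ι, fun q => (B q).isSmoothProjective.geometricallyIrreducible, hcol, ι',
    fun q' => (B' q').isSmoothProjective.geometricallyIrreducible, fun q z₁ z₂ => ?_⟩
  -- every complex point of the piece `X_q` is `[x, g_q K]` for a ball point `x`
  have hpt : ∀ z : ComplexPoints (X q), ∃ x : Ball, AlgPoints.map (ι q) z =
      AlgPoints.baseChangeEquiv τ (S.M.obj K) ((S.pts K).symm (ShimuraSet.mk L H τ T hT K.1.1 x (g q))) := by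
    intro z
    obtain ⟨hH, -, hpts⟩ := hB q
    obtain ⟨w, hw, rfl⟩ := (B q).surjOn_unif (Set.mem_univ z)
    have hw' : w ∈ negCone (H.map τ) := by
      rw [← hH]
      exact hw
    obtain ⟨x, c, hc, rfl⟩ := exists_ball_smul_of_mem_negCone hT hw'
    have hcone : (T : Matrix (Fin 3) (Fin 3) ℂ) *ᵥ BallModel.lift x ∈ (B q).cone := by
      change _ ∈ negCone (B q).Hℂ
      rw [hH]
      exact frame_mulVec_lift_mem_negCone hT x
    exact ⟨x, by rw [(B q).unif_smul hc hcone, hpts]⟩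
  -- at level `K'`: the class `q'` of `g_q` and a rational `γ` with `[x, g_q K'] = [γ x, g'_{q'} K']`
  obtain ⟨γ, hγ⟩ := exists_rational_rep hg' (g q)
  set q' : orbitRel.Quotient (rational (↥(maximalRealSubfield L)) L (IsCMField.complexConj L) 3 H)
      (CosetSpace (rationalToFinAdelic (↥(maximalRealSubfield L)) L (IsCMField.complexConj L) 3 H) K'.1.1) :=
    Quotient.mk'' (CosetSpace.pt (rationalToFinAdelic (↥(maximalRealSubfield L)) L (IsCMField.complexConj L) 3 H) K'.1.1 (g q))
    with hq'
  have hmk : ∀ x : Ball, ShimuraSet.mk L H τ T hT K'.1.1 x (g q) =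
      ShimuraSet.mk L H τ T hT K'.1.1 (ratToU21 L H τ T hT γ • x) (g' q') := fun x => by
    refine (ShimuraSet.mk_eq_mk_iff L H τ T hT K'.1.1 _ _ _ _).mpr ⟨γ⁻¹, ?_, ?_⟩
    · rw [smul_smul, ← map_mul, inv_mul_cancel, map_one, one_smul]
    · simpa only [map_inv, _root_.mul_inv_rev, mul_assoc] using hγ
  -- the points `[γ x]` of the piece `X'_{q'}` map to `[x, g_q K]` under the transition
  have hlift : ∀ x : Ball, AlgPoints.map (ι' q' ≫ (baseChangeHom τ).map (S.M.map f))
      ((B' q').unif ((T : Matrix (Fin 3) (Fin 3) ℂ) *ᵥ BallModel.lift (ratToU21 L H τ T hT γ • x))) =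
      AlgPoints.baseChangeEquiv τ (S.M.obj K) ((S.pts K).symm (ShimuraSet.mk L H τ T hT K.1.1 x (g q))) := by
    intro x
    obtain ⟨-, -, hpts'⟩ := hB' q'
    rw [AlgPoints.map_comp_apply, hpts', ← hmk, ← AlgPoints.baseChangeEquiv_map,
      ← (S.pts K).symm_apply_apply (AlgPoints.map (S.M.map f) _), S.map_pts K' K f]
  obtain ⟨x₁, hx₁⟩ := hpt z₁
  obtain ⟨x₂, hx₂⟩ := hpt z₂
  exact ⟨q', _, _, (hlift x₁).trans hx₁.symm, (hlift x₂).trans hx₂.symm⟩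

end Record

/-! ## §2 The honest §4.2 datum on the canonical models: `Alb_{u^{K'}_K}` is an epimorphism -/

section Honest

/-- `ῑ₁ ∘ c = ι₁` for the complex conjugation `c` of the CM field `F` and `ῑ₁ = conj ∘ ι₁` (`ι₁ (c x) = conj (ι₁ x)`). [folklore] -/
private theorem conj_comp_cmConjRingHom {F : CMField} (ι₁ : F →+* ℂ) :
    ((starRingEnd ℂ).comp ι₁).comp (cmConjRingHom F) = ι₁ :=
  RingHom.ext fun x => by
    simp only [RingHom.coe_comp, Function.comp_apply, embedding_cmConjRingHom, starRingEnd_self_apply]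

/-- **(I) at the explicit honest datum** (`4 ≤ [F:ℚ]`, Compact Case): every transition homomorphism
`Alb_{u^{K'}_K} = (sec42DataOfFourLe h V Φ h4 iso).Atr f` of the Albanese tower of `X_K = M_K ⊗_{F,c} F` (`M` the total record functor of the
canonical models, `recordFunctorOf h V ≅ (recordOf h V h4).M`) is an EPIMORPHISM of abelian varieties.  Proof: §1 at `S := recordOf h V h4`,
transported along the natural isomorphisms `X_K ⊗_{F,ῑ₁} ℂ = (M_K ⊗_c F) ⊗_{ῑ₁} ℂ ≅ M_K ⊗_{F,ι₁} ℂ` (`baseChangeHomObjIsoOfComp`, `ῑ₁ ∘ c = ι₁`;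
`recordFunctorOfIso`), into the generic engine `Sec42Data.epi_Atr_of_pieces_lift_iso` (`∇u^{K'}_K` surjective on `ℂ`-points ⇒ `Alb_u` epi).
CONDITIONAL on the named fact `h : exists_recordSystem` ([Deligne1979] 2.2.5) only.  HC_CM is NOT proved.
[cite: Liu2021, Thm. 4.18 (1) proof (FJcycle.tex l. 2247–2282), §4.2 l. 2060–2072, Def. 2.3] [cite: Deligne1979ShimuraVarieties, 2.1.2–2.1.4 and 2.2.5] -/
theorem albTransitionEpi_sec42DataOfFourLe (h : exists_recordSystem) {F : CMField} {ι₁ : F →+* ℂ} (V : HermSpace3 F ι₁)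
    (Φ : CMType F) (h4 : 4 ≤ Module.finrank ℚ F) (iso : ℕ → Prop)
    ⦃K K' : C5.SmallLevel (K3 V)⦄ (f : K' ⟶ K) :
    Epi ((sec42DataOfFourLe h V Φ h4 iso).Atr f) := by
  letI : Algebra (F : Type) ℂ := ((starRingEnd ℂ).comp ι₁).toAlgebra
  have hι := conj_comp_cmConjRingHom ι₁
  -- `Θ_K : X_K ⊗_{ῑ₁} ℂ = (M_K ⊗_c F) ⊗_{ῑ₁} ℂ ≅ M_K ⊗_{ι₁} ℂ`, natural in `K` (`X_K = (recordFunctorOf h V) K ⊗_c F` by `rfl`)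
  let Θ : ∀ K : C5.SmallLevel (K3 V),
      (baseChangeHom ((starRingEnd ℂ).comp ι₁)).obj ((baseChangeHom (cmConjRingHom F)).obj ((recordFunctorOf h V).obj K)) ≅
        (baseChangeHom ι₁).obj ((recordOf h V h4).M.obj K) := fun K =>
    baseChangeHomObjIsoOfComp (cmConjRingHom F) ((starRingEnd ℂ).comp ι₁) ι₁ hι ((recordFunctorOf h V).obj K) ≪≫
      (baseChangeHom ι₁).mapIso ((recordFunctorOfIso h V h4).app K)
  have hΘ : (baseChangeHom ((starRingEnd ℂ).comp ι₁)).map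
        ((baseChangeHom (cmConjRingHom F)).map ((recordFunctorOf h V).map f)) ≫ (Θ K).hom =
      (Θ K').hom ≫ (baseChangeHom ι₁).map ((recordOf h V h4).M.map f) := by
    simp only [Θ, Iso.trans_hom, Functor.mapIso_hom, Iso.app_hom, Category.assoc]
    rw [baseChangeHomObjIsoOfComp_comm_assoc, ← Functor.map_comp, NatTrans.naturality, Functor.map_comp]
  -- the same square in the engine's syntactic form, through `.left` components (kernel hygiene: the kernel never compares two
  -- `Over`-compositions whose factors are different terms)
  have hu : (AbelianVariety.bcFunctor F ℂ).map ((sec42DataOfFourLe h V Φ h4 iso).cpt.X.map f) ≫ (Θ K).hom =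
      (Θ K').hom ≫ (baseChangeHom ι₁).map ((recordOf h V h4).M.map f) := by
    refine Over.OverMorphism.ext ?_
    have h2 := congrArg CommaMorphism.left hΘ
    simp only [Over.comp_left] at h2 ⊢
    exact h2
  obtain ⟨κ, κ', P, P', inj, hP, hcol, inj', hP', hl⟩ := recordSystem_pieces_pair_lift (recordOf h V h4) f
  haveI := hP
  haveI := hP'
  exact (sec42DataOfFourLe h V Φ h4 iso).epi_Atr_of_pieces_lift_iso f (Θ K) (Θ K')
    ((baseChangeHom ι₁).map ((recordOf h V h4).M.map f)) hu inj hcol inj' hl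

end Honest

/-! ## §3 The registered stub (I) `StubAlbTransitionEpi`, verbatim -/

/-- **`stub_albTransitionEpi` CLOSED: `StubAlbTransitionEpi` of `Lines/a3-liu418.lean` v3 (sha16 1b96ade3f8b6b529, :501) VERBATIM** (`CV hDel F V Φ`
unfolded): for every `hDel` and every face `(F, ι₁, V, Φ)` with `6 ≤ [F:ℚ]`, every transition homomorphism `Alb_{u^{K'}_K}` of the Albanese tower of
`ℭ_V = sec42DataOf (exists_recordSystem_of_printed hDel) isoOf ⟨F⟩ ι₁ V̂ Φ` is an epimorphism of abelian varieties — §2 after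
`Model.sec42DataOf_eq_of_four_le` (`6 ≤ [F:ℚ] ⇒ 4 ≤ [F:ℚ]`).  Cell INVENTORY row VI-3 `AlbTransitionEpi` at debt 0 (the only input is the
stub's own binder `hDel`).  ORIENTATION: none.  HC_CM is proved only modulo the 7 printed citations until rung 0 closes.
[cite: Liu2021, Thm. 4.18 (1) proof (FJcycle.tex l. 2274–2282); Lem. 2.4 (1); Def. 2.3] [cite: Deligne1979ShimuraVarieties, 2.1.2–2.1.4, 2.2.5 and Cor. 2.7.21] -/
theorem stubAlbTransitionEpi_holds :
    ∀ (hDel : Literature.AlgebraicGeometry.ShimuraVarieties.UnitaryCanonicalModel.canonicalModel_exists_printed)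
      (F : HodgeCM.CMField) [IsGalois ℚ F] (h6 : 6 ≤ Module.finrank ℚ F) {ι₁ : F →+* ℂ} (V : HodgeCM.HermSpace3 F ι₁) (Φ : CMType F)
      ⦃K K' : C5.SmallLevel (sec42DataOf (Summit.HodgeConjecture.CorCM.DelRec.exists_recordSystem_of_printed hDel) isoOf ⟨HodgeCM.CMField.K F⟩ ι₁ ⟨HodgeCM.HermSpace3.Hm V, HodgeCM.HermSpace3.isHermitian V, HodgeCM.HermSpace3.signature_ι₁ V, HodgeCM.HermSpace3.posDef_of_ne V⟩ Φ).S.K₀⦄ (f : K' ⟶ K), CategoryTheory.Epi ((sec42DataOf (Summit.HodgeConjecture.CorCM.DelRec.exists_recordSystem_of_printed hDel) isoOf ⟨HodgeCM.CMField.K F⟩ ι₁ ⟨HodgeCM.HermSpace3.Hm V, HodgeCM.HermSpace3.isHermitian V, HodgeCM.HermSpace3.signature_ι₁ V, HodgeCM.HermSpace3.posDef_of_ne V⟩ Φ).Atr f) := by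
  intro hDel F _ h6 ι₁ V Φ
  have h4 : 4 ≤ Module.finrank ℚ (⟨HodgeCM.CMField.K F⟩ : CMField) := le_trans (by norm_num) h6
  rw [sec42DataOf_eq_of_four_le _ _ Φ isoOf h4]
  exact albTransitionEpi_sec42DataOfFourLe _ _ Φ h4 _

end Summit.HodgeConjecture.CorCM.Lines.A3Liu418

end
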